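import Summits.MatrixMultiplication.MatrixMultiplication.Theses.SnSubsetDichotomy

/-!
# Line `zonal-rank-hamiltonian-overlay` — crux `SnSubsetDichotomy.HyperoctahedralSubsets`
(stmt-MatrixMultiplication-8305), skeleton

CRUX (rank 4 of route SnSubsetDichotomy, fixed): `∃ c > 0, ∃ n₀, ∀ n ≥ n₀`, for three
fixed-point-free involutions `μ i` of `Fin n` (perfect matchings `M_i`, hosts
`B_i := C(μ i) ≅ S_2 ≀ S_{n/2}`, `|B_i| = 2^m m!`, `n = 2m`) and `X i ⊆ B_i` with the triple product
property, `|X 0| |X 1| |X 2| ≤ (n!)^{3/2} e^{-c√n}`.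

THE LEVER (idea card `zonal-rank-hamiltonian-overlay`, ideator 2, merged by the r1 triage panel with
`spherical-rank-sieve` ≈ `visibility-rank-spherical-vanishing`): the triple condition, read through
quotient sets `Q(X) = X X⁻¹`, says that `Q(X 1) ∖ {1}` avoids the OVERLAY SET
`Q(X 0) · Q(X 2) ⊆ B₀ B₂`; a set whose quotients avoid the support of a kernel `k` with
`k 1 ≠ 0` indexes a scalar principal submatrix of the convolution matrix `(k(a b⁻¹))_{a,b}`, so
`|X 1| ≤ rank` (Haemers / Lovász–Bollobás set-pair bound — RANK, not the Hoffman ratio, which only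
saves `2(m-1)` here: `ω^{(m-1,1)}_{(m)} = -1/(2(m-1))`, Macdonald VII.2 Ex. 2(e)); and for the
HOST overlay kernel `1_{B₀B₂}` the rank is the visibility rank of the perfect-matching association
scheme, `Σ_{λ ⊢ m : ω^λ_τ ≠ 0} f^{2λ}` (Gelfand pair `(S_{2m}, B_m)`, Macdonald VII.2 Ex. 5), which
COLLAPSES when the 2-factor `M₀ ∪ M₂` has a long cycle: `ω^λ_{(m)} = 0` iff `λ ⊇ (2,2,2)`
(Macdonald VII.2 Ex. 2(c)); in Hamiltonian position the rank is
`F(m) = Σ_{λ₃ ≤ 1} f^{2λ} = Θ(16^m/m²) ≤ 4^n` (exact `9933, 114114, 1383525` at `m = 6,7,8`;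
`7.7·10⁻⁷³·(n-1)!!` at `n = 200`; all three triagers reproduced it), against
`|B| = √(n!)(πn/2)^{1/4}`.

THE SKELETON (4 registered stubs; `HyperoctahedralSubsets_of` composes them into the crux BY NAME,
kernel-checked, no `sorry` of its own; regime split on the pair `(0,2)` only):
* `stub_hostPacking` (M, provable now) — PACKING REGIME: pair-injective `X ⊆ C(μ)`, `Y ⊆ C(ν)`
  have `|X| |Y| |C(μ) ∩ C(ν)| ≤ |C(μ)| |C(ν)| = (2^m m!)² ≤ n! e^{ε√n}` eventually
  (`4^m/binom(2m,m) ~ √(πm)`). Used three ways by the glue: the short-cycle case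
  `|C(μ₀) ∩ C(μ₂)| ≥ e^{c₁√n}`, the host size `|C(μ)|² ≤ n! e^{ε√n}` (take `Y = {1}`, `ν = μ`),
  and the lopsided sub-cases.
* `stub_kernelSieve` (M, provable now) — THE RANK LEVER in kernel form (any group, any finite
  ambient set `H ⊇ X`): `k 1 ≠ 0` and `k(x x'⁻¹) = 0` for `x ≠ x'` in `X` give
  `|X| ≤ rank (k(a b⁻¹))_{a,b ∈ H}`.
* `stub_hostPairRank` (XL, the level-0 theorem of the merged lever) — LONG-CYCLE VANISHING:
  `∀ Γ ∃ c'`: if `|C(μ) ∩ C(ν)| ≤ e^{c'√n}` (few alternating cycles, `z_{2τ} = ∏(2k)^{c_k} c_k! ≥ 2^L`)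
  then the host overlay matrix `1[a b⁻¹ ∈ C(μ)C(ν)]` has rank `≤ √(n!)·e^{-Γ√n}`
  (Macdonald VII.2 Ex. 2(c)+5, the `[p_τ]`-support criterion "`ω^λ_τ ≠ 0 ⇒ λ` contains a thin
  (`ν₃ ≤ 1`) shape of size `τ₁`", and a first-moment LIS/LDS large deviation for random
  fixed-point-free involutions, `f^{2λ}/(2m-1)!!` being their RS-shape law).
* `stub_activePairTransfer` (open — the HARDEST stub, the line's bet, replacing the card's
  expander-mixing `ActiveQuotientSupersaturation` that triage r1-2 showed void below density
  `m^{-1/2}`) — HOST-TO-SUBSET TRANSFER OF LOW RANK: in long-cycle position with the host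
  certificate of `stub_hostPairRank`, every ACTIVE pair `X₀ ⊆ B₀`, `X₂ ⊆ B₂`
  (`|X_i| ≥ |B_i| e^{-c√n}`) with `Q(X₀) ∩ Q(X₂) = {1}` admits a kernel `k` supported on the active
  overlay set `Q(X₀)Q(X₂)`, `k 1 ≠ 0`, whose convolution matrix on the third host `B₁` has rank
  `≤ √(n!)·e^{-c√n}` — i.e. the Haemers minrank of the active overlay graph on `B₁` is a factor
  `e^{c√n}` below the trivial `|B₁|`. TPP-free (pairwise hypotheses only); for saturated pairs
  (`Q(X_i) = B_i`: subgroups, random dense sets) it is `stub_hostPairRank` with `k = 1_{B₀B₂}`.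
GLUE (`HyperoctahedralSubsets_of`, proved): with `Γ, c_D` from the transfer stub, `c_C(Γ)` from the
host-rank stub, `c₁ = min(c_C, c_D)`, `ε = c₁/2`, final `c = c₁/4`: if
`z₀₂ = |B₀ ∩ B₂| ≥ e^{c₁√n}`, packing gives `∏ ≤ |B₁|·n!e^{ε√n}/z₀₂ ≤ (n!)^{3/2}e^{-c₁√n/4}`; else
the host certificate holds, and either some `X_i` (`i = 0, 2`) is inactive
(`∏ < e^{-c_D√n}|B₀||B₁||B₂| ≤ (n!)^{3/2}e^{(3ε/2-c_D)√n}`) or the transfer kernel and the sieve give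
`|X 1| ≤ √(n!)e^{-c_D√n}` and `∏ ≤ (n!)^{3/2}e^{(ε-c_D)√n}`. The TPP enters exactly twice: pair
injectivity of `(x₀,x₂) ↦ x₀⁻¹x₂` / `Q(X₀) ∩ Q(X₂) = {1}`, and "`Q(X 1) ∖ 1` misses `Q(X₀)Q(X₂)`"
(the sieve hypothesis) — `false_without_TPP` of the standing Disproof is honoured there, and
`withoutFPF`/`withoutHost` by the host hypotheses every stub carries.

References: Macdonald 1995 *Symmetric functions and Hall polynomials* VII.1–2, Ex. 2(c), 2(e), 5
(held, p0332–0333 read by the triagers); BlasiakChurchCohnGrochowUmans2017 (arXiv:1712.02302) §4–5;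
BlasiakCohnGrochowPrattUmans2023 (arXiv:2204.03826) Thm 3.2; Haemers 1979 (minrank bound);
Baik–Rains 2001 (doi:10.1215/s0012-7094-01-10921-6, monotone subsequences of random involutions);
Godsil–Meagher arXiv:1506.08770 (perfect-matching scheme). Line card: `Lines/zonal-rank-hamiltonian-overlay.md`.
-/

set_option linter.dupNamespace false

open scoped Pointwise Classical

namespace Summit.MatrixMultiplication.MatrixMultiplication.Cruxes.HyperoctahedralSubsets.ZonalRankHamiltonianOverlay

open Literature.Combinatorics.Additive

/-! ### Objects (transparent abbreviations) -/

/-- The HOST of a permutation `μ` as a finite set: its centraliser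
`{σ : σ μ = μ σ}` (for a fixed-point-free involution `μ` of `Fin (2m)` this is
`B(M_μ) ≅ S_2 ≀ S_m`, of order `2^m m!`). The crux's hypothesis `∀ σ ∈ X i, σ * μ i = μ i * σ`
says `X i ⊆ host (μ i)`. -/
def host {n : ℕ} (μ : Equiv.Perm (Fin n)) : Finset (Equiv.Perm (Fin n)) :=
  Finset.univ.filter (fun σ => σ * μ = μ * σ)

/-- The HOST OVERLAY (visibility) matrix of a pair of hosts: `W[a,b] = 1` iff `a b⁻¹ ∈ C(μ)·C(ν)`.
For matching hosts it is the class matrix `A_τ` of the perfect-matching association scheme lifted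
to `S_n` (`τ ⊢ n/2` the coset type of `M_μ ∪ M_ν`); its rank is `Σ_{ω^λ_τ ≠ 0} f^{2λ}`. -/
noncomputable def hostVis {n : ℕ} (μ ν : Equiv.Perm (Fin n)) :
    Matrix (Equiv.Perm (Fin n)) (Equiv.Perm (Fin n)) ℝ :=
  Matrix.of fun a b => if a * b⁻¹ ∈ host μ * host ν then 1 else 0

/-- The convolution (kernel) matrix of a real kernel `k : G → ℝ` on a finite ambient set `H`:
`(a, b) ↦ k (a b⁻¹)` (real kernels: the characters of `S_n` and of `S_2 ≀ S_m` are rational, so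
nothing is lost against `ℂ` up to a factor `2` in rank). -/
def kerMat {G : Type*} [Group G] (H : Finset G) (k : G → ℝ) : Matrix H H ℝ :=
  Matrix.of fun a b => k (a.1 * b.1⁻¹)

/-! ### The four stub STATEMENTS (named `Prop`s; the registered `stub_*` theorems below restate
them verbatim, and `Registered.stub_*` are their name-keyed aliases used as the hypotheses of
`HyperoctahedralSubsets_of` — the native skeleton audit admits hypotheses BY NAME; same device as
`Summits/ABC/ABC/Cruxes/MazurKaneLaw/Lines/fibre-toolkit-lp-wall-map.lean`). -/

/-- Statement of STUB A (packing regime + host order): for every `ε > 0`, eventually in `n`, two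
fixed-point-free involutions `μ, ν` of `Fin n` and PAIR-INJECTIVE sets `X ⊆ C(μ)`, `Y ⊆ C(ν)`
(`x x'⁻¹ y y'⁻¹ = 1 ⇒ x = x', y = y'`, the two-set trace of the TPP) satisfy
`|X|·|Y|·|C(μ) ∩ C(ν)| ≤ n!·e^{ε√n}`. (Truth: `(x,y) ↦ x⁻¹y` injects `X × Y` into the product set
`C(μ)C(ν)` of size `|C(μ)||C(ν)|/|C(μ) ∩ C(ν)|`, and `|C(μ)|² = (2^m m!)² = (2m)!·4^m/binom(2m,m)
≤ (2m)!·2√m ≤ n! e^{ε√n}` for `n ≥ n₀(ε)`; odd `n` is vacuous, `n = 0` reads `1 ≤ 1`.) -/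
def HostPacking : Prop :=
  ∀ ε : ℝ, 0 < ε → ∃ n₀ : ℕ, ∀ n ≥ n₀, ∀ μ ν : Equiv.Perm (Fin n),
    (μ * μ = 1 ∧ ∀ x, μ x ≠ x) → (ν * ν = 1 ∧ ∀ x, ν x ≠ x) →
    ∀ X Y : Finset (Equiv.Perm (Fin n)), X ⊆ host μ → Y ⊆ host ν →
      (∀ x ∈ X, ∀ x' ∈ X, ∀ y ∈ Y, ∀ y' ∈ Y, x * x'⁻¹ * (y * y'⁻¹) = 1 → x = x' ∧ y = y') →
      ((X.card * Y.card * (host μ ∩ host ν).card : ℕ) : ℝ)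
        ≤ (n.factorial : ℝ) * Real.exp (ε * Real.sqrt (n : ℝ))

/-- Statement of STUB B (the rank lever, kernel form; any group): if `X ⊆ H`, `k 1 ≠ 0` and
`k (x x'⁻¹) = 0` for all `x ≠ x'` in `X`, then `|X| ≤ rank (k (a b⁻¹))_{a,b ∈ H}` — the `X × X`
principal submatrix is `k(1)·Id`. -/
def KernelSieve : Prop :=
  ∀ (G : Type) [Group G] (H X : Finset G) (k : G → ℝ), X ⊆ H → k 1 ≠ 0 →
    (∀ x ∈ X, ∀ x' ∈ X, x ≠ x' → k (x * x'⁻¹) = 0) → X.card ≤ (kerMat H k).rank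

/-- Statement of STUB C (long-cycle vanishing of the host overlay rank — the level-0 theorem of the
merged rank lever): for every `Γ > 0` there are `c > 0`, `n₀` such that for `n ≥ n₀` and
fixed-point-free involutions `μ, ν` of `Fin n` whose hosts meet in at most `e^{c√n}` elements (so the
2-factor `M_μ ∪ M_ν` has `< c√n/ln 2` alternating cycles, one of half-length `τ₁ ≥ (ln 2/(c√2))√m`),
`rank (hostVis μ ν) ≤ √(n!)·e^{-Γ√n}`. (Why: `rank = Σ_{ω^λ_τ ≠ 0} f^{2λ}` by Gelfand multiplicity
one + Macdonald VII.2 Ex. 5; `ω^λ_τ ≠ 0 ⇒ λ ⊇` a thin shape `ν ⊢ τ₁`, `ν₃ ≤ 1` (expand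
`p_{τ₁} = Σ_ν a_ν J_ν` with `a_ν ∝ ω^ν_{(τ₁)}`, nonzero iff `ν₃ ≤ 1` by Ex. 2(c), then Pieri
containment); hence `2λ₁ ≥ 2τ₁/3` or `ℓ(λ) > τ₁/3`, i.e. `LDS` or `LIS` of the fixed-point-free
involution with RS shape `(2λ)'` — law `f^{2λ}/(2m-1)!!` — exceeds `(const/c)·√n`, a first-moment
large deviation of speed `√n` and rate `→ ∞` as `c → 0`; and `(2m-1)!! ≤ √(n!)`. Hamiltonian case:
rank `= F(m) ≤ 4^n`, numerically exact to `m = 8` and `≤ 4^n` to `n = 1600`.) -/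
def HostPairRank : Prop :=
  ∀ Γ : ℝ, 0 < Γ → ∃ c : ℝ, 0 < c ∧ ∃ n₀ : ℕ, ∀ n ≥ n₀, ∀ μ ν : Equiv.Perm (Fin n),
    (μ * μ = 1 ∧ ∀ x, μ x ≠ x) → (ν * ν = 1 ∧ ∀ x, ν x ≠ x) →
    ((host μ ∩ host ν).card : ℝ) ≤ Real.exp (c * Real.sqrt (n : ℝ)) →
    ((hostVis μ ν).rank : ℝ) ≤ Real.sqrt (n.factorial : ℝ) * Real.exp (-(Γ * Real.sqrt (n : ℝ)))

/-- Statement of STUB D (the open residual — HOST-TO-SUBSET TRANSFER of low overlay rank; TPP-free,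
pairwise hypotheses only): there are `Γ, c > 0`, `n₀` such that for `n ≥ n₀`, fixed-point-free
involutions `μ₀, μ₁, μ₂` of `Fin n` with the pair `(μ₀, μ₂)` in long-cycle position
(`|C(μ₀) ∩ C(μ₂)| ≤ e^{c√n}`) and host-certified (`rank (hostVis μ₀ μ₂) ≤ √(n!) e^{-Γ√n}`, the
output of STUB C), every ACTIVE pair `X₀ ⊆ C(μ₀)`, `X₂ ⊆ C(μ₂)` (`|C(μ_i)| ≤ |X_i| e^{c√n}`) with
`Q(X₀) ∩ Q(X₂) ⊆ {1}` admits a kernel `k` on `S_n`, `k 1 ≠ 0`, supported on the active overlay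
set `Q(X₀)·Q(X₂)`, whose convolution matrix on the third host `C(μ₁)` has rank
`≤ √(n!)·e^{-c√n}` (a factor `≈ e^{c√n} n^{1/4}` below the trivial `|C(μ₁)|`). Saturated pairs
(`Q(X_i) = C(μ_i)`) are STUB C with `k = 1_{C(μ₀)C(μ₂)}`; the first open instances are two
differently-rooted sub-hosts `C(μ_i) ∩ Stab(r_i)` and two rooted torus Hamming balls / parity-product
sets (triage E1–E3, X_H), where `1_{C(μ₀)C(μ₂)}` restricted to `Q(X₀)Q(X₂)` is no longer
admissible and the Turán repair is void. -/
def ActivePairTransfer : Prop :=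
  ∃ Γ : ℝ, 0 < Γ ∧ ∃ c : ℝ, 0 < c ∧ ∃ n₀ : ℕ, ∀ n ≥ n₀, ∀ μ₀ μ₁ μ₂ : Equiv.Perm (Fin n),
    (μ₀ * μ₀ = 1 ∧ ∀ x, μ₀ x ≠ x) → (μ₁ * μ₁ = 1 ∧ ∀ x, μ₁ x ≠ x) → (μ₂ * μ₂ = 1 ∧ ∀ x, μ₂ x ≠ x) →
    ((host μ₀ ∩ host μ₂).card : ℝ) ≤ Real.exp (c * Real.sqrt (n : ℝ)) →
    ((hostVis μ₀ μ₂).rank : ℝ) ≤ Real.sqrt (n.factorial : ℝ) * Real.exp (-(Γ * Real.sqrt (n : ℝ))) →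
    ∀ X₀ X₂ : Finset (Equiv.Perm (Fin n)), X₀ ⊆ host μ₀ → X₂ ⊆ host μ₂ →
      ((host μ₀).card : ℝ) ≤ (X₀.card : ℝ) * Real.exp (c * Real.sqrt (n : ℝ)) →
      ((host μ₂).card : ℝ) ≤ (X₂.card : ℝ) * Real.exp (c * Real.sqrt (n : ℝ)) →
      X₀ * X₀⁻¹ ∩ (X₂ * X₂⁻¹) ⊆ {1} →
      ∃ k : Equiv.Perm (Fin n) → ℝ, k 1 ≠ 0 ∧ (∀ g, k g ≠ 0 → g ∈ X₀ * X₀⁻¹ * (X₂ * X₂⁻¹)) ∧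
        ((kerMat (host μ₁) k).rank : ℝ)
          ≤ Real.sqrt (n.factorial : ℝ) * Real.exp (-(c * Real.sqrt (n : ℝ)))

/-! ### The registered stubs -/

/-- STUB A (M, provable now) — PACKING REGIME + HOST ORDER. `|X||Y||C(μ) ∩ C(ν)| ≤ |C(μ)||C(ν)|`
by injectivity of `(x, y) ↦ x⁻¹ y : X × Y → C(μ)C(ν)` (tree pattern
`Literature.Barriers.MatrixMultiplication.SubgroupTPP` / `card_mul_card_le_card_inf_mul_card` in
`NormalizerBarrier.lean`, `Subgroup.card_mul_eq_card_subgroup_mul_card_quotient`-type counting), then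
`|C(μ)| = 2^m·m!` from `Equiv.Perm.nat_card_centralizer` (cycle type `{2^m}`) and
`(2^m m!)² = (2m)!·4^m/((2m).choose m) ≤ (2m)!·(2m+1)` (`Nat.four_pow_le_two_mul_self_mul_centralBinom`),
finally `2m + 1 ≤ e^{ε√(2m)}` for `m ≥ m₀(ε)` (`Real.add_one_le_exp`/`Real.pow_div_factorial_le_exp`). -/
theorem stub_hostPacking :
    ∀ ε : ℝ, 0 < ε → ∃ n₀ : ℕ, ∀ n ≥ n₀, ∀ μ ν : Equiv.Perm (Fin n),
    (μ * μ = 1 ∧ ∀ x, μ x ≠ x) → (ν * ν = 1 ∧ ∀ x, ν x ≠ x) →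
    ∀ X Y : Finset (Equiv.Perm (Fin n)), X ⊆ host μ → Y ⊆ host ν →
      (∀ x ∈ X, ∀ x' ∈ X, ∀ y ∈ Y, ∀ y' ∈ Y, x * x'⁻¹ * (y * y'⁻¹) = 1 → x = x' ∧ y = y') →
      ((X.card * Y.card * (host μ ∩ host ν).card : ℕ) : ℝ)
        ≤ (n.factorial : ℝ) * Real.exp (ε * Real.sqrt (n : ℝ)) := by
  sorry

/-- STUB B (M, provable now) — THE RANK LEVER (Haemers / set-pair, kernel form): the `X × X`
principal submatrix of `kerMat H k` is `k 1 • 1`, so `|X| = rank` of it `≤ rank (kerMat H k)`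
(`Matrix.rank_submatrix_le`-type monotonicity via `LinearMap.range` of `mulVecLin` composed with the
coordinate inclusion/projection `X ↪ H`; `Matrix.rank_diagonal`/`rank_smul`). -/
theorem stub_kernelSieve :
    ∀ (G : Type) [Group G] (H X : Finset G) (k : G → ℝ), X ⊆ H → k 1 ≠ 0 →
    (∀ x ∈ X, ∀ x' ∈ X, x ≠ x' → k (x * x'⁻¹) = 0) → X.card ≤ (kerMat H k).rank := by
  sorry

/-- STUB C (XL; the level-0 theorem of the merged rank lever — true in print modulo the large-deviation
bookkeeping, numerically certified) — LONG-CYCLE VANISHING OF THE HOST OVERLAY RANK. Plan for the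
prover (helper lemmas ride with `--supports`): (1) `hostVis μ ν` is constant on left `C(μ)`-cosets ×
left `C(ν)`-cosets and equals the lifted class matrix `A_τ` of the perfect-matching scheme, so
`rank = #{λ ⊢ m : ω^λ_τ ≠ 0}`-weighted `Σ f^{2λ}` (Gelfand pair `(S_{2m}, B_m)`: Macdonald VII (1.4)–(1.5),
(2.4) `1_B^{S_{2m}} = ⊕ S^{2λ}`, Ex. 5); (2) `|C(μ) ∩ C(ν)| = z_{2τ} = ∏ (2k)^{c_k} c_k! ≥ 2^{ℓ(τ)}`
(Macdonald VII (2.3)); (3) support criterion `ω^λ_τ ≠ 0 ⇒ λ₁ + λ₂ + (ℓ(λ) - 2)⁺ ≥ τ₁` (Ex. 2(c) for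
`τ = (m)`; general `τ` via `p_τ = p_{τ'} p_{τ₁}`, `p_{τ₁} ∈ span{J_ν : ν ⊢ τ₁, ν₃ ≤ 1}` and Pieri
containment VI (7.4)/VII (2.28); verified with 0 violations for all `λ, τ`, `m ≤ 7`, by two triagers and
to `m ≤ 13` by the ideator); (4) `f^{2λ}/(2m-1)!! = P(RS-shape of a uniform fpf involution = (2λ)')`
(Schützenberger), `ℓ(λ) = LIS`, `2λ₁ = LDS`, and the first-moment tails
`P(LIS ≥ y√(2m)) ≤ (e²/y²)^{y√(2m)}`-type; (5) `(2m-1)!! = n!/|B| ≤ √(n!)`. -/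
theorem stub_hostPairRank :
    ∀ Γ : ℝ, 0 < Γ → ∃ c : ℝ, 0 < c ∧ ∃ n₀ : ℕ, ∀ n ≥ n₀, ∀ μ ν : Equiv.Perm (Fin n),
    (μ * μ = 1 ∧ ∀ x, μ x ≠ x) → (ν * ν = 1 ∧ ∀ x, ν x ≠ x) →
    ((host μ ∩ host ν).card : ℝ) ≤ Real.exp (c * Real.sqrt (n : ℝ)) →
    ((hostVis μ ν).rank : ℝ) ≤ Real.sqrt (n.factorial : ℝ) * Real.exp (-(Γ * Real.sqrt (n : ℝ))) := by
  sorry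

/-- STUB D (open; HARDEST — the line's bet) — HOST-TO-SUBSET TRANSFER OF LOW OVERLAY RANK
(Haemers minrank of the ACTIVE overlay graph on the third host). See `ActivePairTransfer`. It is the
exact residual of the rank lever for subsets: STUB B turns any such kernel into `|X 1| ≤ rank`, and the
TPP supplies precisely its two hypotheses (`Q(X₀) ∩ Q(X₂) = {1}`, `Q(X 1) ∖ 1 ∩ Q(X₀)Q(X₂) = ∅`).
Known cases: saturated pairs (STUB C); one rooted host + one set of size `> |B|/2`
(`C(μ₀) = K₀·D`, `D = C(μ₀) ∩ C(μ₂)`); common-root rooted pairs (zeros inherited exactly, `vr = n·F(m)`,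
triage r1-1/2/3). Cheapest falsifier: two DIFFERENTLY rooted sub-hosts in Hamiltonian position at
`n = 12, 14, 16` — compute the largest `X 1 ⊆ C(μ₁)` with `Q(X 1) ∩ K₀K₂ = {1}` and the rank of
`1_{K₀K₂}` restricted to `C(μ₁)` (triage r1-2 measured the `S_n`-level rank `≥ 0.52·[S_n:K]`, so the
host-level kernel is NOT admissible evidence there; the `C(μ₁)`-restricted minrank is the open number). -/
theorem stub_activePairTransfer :
    ∃ Γ : ℝ, 0 < Γ ∧ ∃ c : ℝ, 0 < c ∧ ∃ n₀ : ℕ, ∀ n ≥ n₀, ∀ μ₀ μ₁ μ₂ : Equiv.Perm (Fin n),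
    (μ₀ * μ₀ = 1 ∧ ∀ x, μ₀ x ≠ x) → (μ₁ * μ₁ = 1 ∧ ∀ x, μ₁ x ≠ x) → (μ₂ * μ₂ = 1 ∧ ∀ x, μ₂ x ≠ x) →
    ((host μ₀ ∩ host μ₂).card : ℝ) ≤ Real.exp (c * Real.sqrt (n : ℝ)) →
    ((hostVis μ₀ μ₂).rank : ℝ) ≤ Real.sqrt (n.factorial : ℝ) * Real.exp (-(Γ * Real.sqrt (n : ℝ))) →
    ∀ X₀ X₂ : Finset (Equiv.Perm (Fin n)), X₀ ⊆ host μ₀ → X₂ ⊆ host μ₂ →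
      ((host μ₀).card : ℝ) ≤ (X₀.card : ℝ) * Real.exp (c * Real.sqrt (n : ℝ)) →
      ((host μ₂).card : ℝ) ≤ (X₂.card : ℝ) * Real.exp (c * Real.sqrt (n : ℝ)) →
      X₀ * X₀⁻¹ ∩ (X₂ * X₂⁻¹) ⊆ {1} →
      ∃ k : Equiv.Perm (Fin n) → ℝ, k 1 ≠ 0 ∧ (∀ g, k g ≠ 0 → g ∈ X₀ * X₀⁻¹ * (X₂ * X₂⁻¹)) ∧
        ((kerMat (host μ₁) k).rank : ℝ)
          ≤ Real.sqrt (n.factorial : ℝ) * Real.exp (-(c * Real.sqrt (n : ℝ))) := by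
  sorry

namespace Registered

/-- Alias of `HostPacking` keyed by the registered stub name. -/
abbrev stub_hostPacking : Prop := HostPacking
/-- Alias of `KernelSieve` keyed by the registered stub name. -/
abbrev stub_kernelSieve : Prop := KernelSieve
/-- Alias of `HostPairRank` keyed by the registered stub name. -/
abbrev stub_hostPairRank : Prop := HostPairRank
/-- Alias of `ActivePairTransfer` keyed by the registered stub name. -/
abbrev stub_activePairTransfer : Prop := ActivePairTransfer

end Registered

/-! ### Glue lemmas (proved): exponents and the three case estimates -/

theorem rpow_three_halves (F : ℝ) (hF : 0 ≤ F) : F ^ ((3 : ℝ) / 2) = F * Real.sqrt F := by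
  have h : (3 : ℝ) / 2 = 1 + 1 / 2 := by norm_num
  rw [h, Real.rpow_add' hF (by norm_num), Real.rpow_one, Real.sqrt_eq_rpow]

/-- Case 1 of the glue (packing regime `e^{c s} ≤ z`). -/
theorem arith_case1 {x0 x1 x2 z F s c : ℝ} (hx1 : 0 ≤ x1)
    (hP : 0 ≤ x0 * x1 * x2) (hF : 0 ≤ F) (hz : Real.exp (c * s) ≤ z)
    (hpair : x0 * x2 * z ≤ F * Real.exp (c / 2 * s))
    (hb1 : x1 ≤ Real.sqrt F * Real.exp (c / 4 * s)) :
    x0 * x1 * x2 ≤ F * Real.sqrt F * Real.exp (-(c / 4 * s)) := by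
  have hE : 0 < Real.exp (c * s) := Real.exp_pos _
  refine le_of_mul_le_mul_right ?_ hE
  have key : Real.exp (c / 2 * s) * Real.exp (c / 4 * s)
      = Real.exp (-(c / 4 * s)) * Real.exp (c * s) := by
    rw [← Real.exp_add, ← Real.exp_add]; congr 1; ring
  calc x0 * x1 * x2 * Real.exp (c * s) ≤ x0 * x1 * x2 * z :=
        mul_le_mul_of_nonneg_left hz hP
    _ = (x0 * x2 * z) * x1 := by ring
    _ ≤ (F * Real.exp (c / 2 * s)) * (Real.sqrt F * Real.exp (c / 4 * s)) :=
        mul_le_mul hpair hb1 hx1 (by positivity)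
    _ = F * Real.sqrt F * Real.exp (-(c / 4 * s)) * Real.exp (c * s) := by
        linear_combination (F * Real.sqrt F) * key

/-- Cases 2a/2b of the glue (a lopsided set: `x0 e^{c_D s} < b0`). -/
theorem arith_case2a {x0 x1 x2 b0 b1 b2 F s c cD : ℝ} (hx0 : 0 ≤ x0) (hx1 : 0 ≤ x1) (hx2 : 0 ≤ x2)
    (hF : 0 ≤ F) (hs : 0 ≤ s) (hcD : c ≤ cD)
    (ha : x0 * Real.exp (cD * s) < b0) (h1 : x1 ≤ b1) (h2 : x2 ≤ b2)
    (hb0 : b0 ≤ Real.sqrt F * Real.exp (c / 4 * s)) (hb1 : b1 ≤ Real.sqrt F * Real.exp (c / 4 * s))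
    (hb2 : b2 ≤ Real.sqrt F * Real.exp (c / 4 * s)) :
    x0 * x1 * x2 ≤ F * Real.sqrt F * Real.exp (-(c / 4 * s)) := by
  have hE : 0 < Real.exp (cD * s) := Real.exp_pos _
  refine le_of_mul_le_mul_right ?_ hE
  have hb0' : 0 ≤ b0 := le_trans (by positivity) ha.le
  have hR0 : 0 ≤ Real.sqrt F * Real.exp (c / 4 * s) := by positivity
  have h3 : Real.exp (c / 4 * s) * Real.exp (c / 4 * s) * Real.exp (c / 4 * s)
      = Real.exp (3 * c / 4 * s) := by
    rw [← Real.exp_add, ← Real.exp_add]; congr 1; ring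
  have hRRR : (Real.sqrt F * Real.exp (c / 4 * s)) * (Real.sqrt F * Real.exp (c / 4 * s))
      * (Real.sqrt F * Real.exp (c / 4 * s)) = F * Real.sqrt F * Real.exp (3 * c / 4 * s) := by
    calc (Real.sqrt F * Real.exp (c / 4 * s)) * (Real.sqrt F * Real.exp (c / 4 * s))
          * (Real.sqrt F * Real.exp (c / 4 * s))
        = (Real.sqrt F * Real.sqrt F) * Real.sqrt F
            * (Real.exp (c / 4 * s) * Real.exp (c / 4 * s) * Real.exp (c / 4 * s)) := by ring
      _ = F * Real.sqrt F * Real.exp (3 * c / 4 * s) := by rw [Real.mul_self_sqrt hF, h3]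
  have hexp : Real.exp (3 * c / 4 * s) ≤ Real.exp (-(c / 4 * s)) * Real.exp (cD * s) := by
    rw [← Real.exp_add, Real.exp_le_exp]
    have := mul_le_mul_of_nonneg_right hcD hs
    linarith
  calc x0 * x1 * x2 * Real.exp (cD * s) = (x0 * Real.exp (cD * s)) * x1 * x2 := by ring
    _ ≤ b0 * b1 * b2 :=
        mul_le_mul (mul_le_mul ha.le h1 hx1 hb0') h2 hx2 (mul_nonneg hb0' (hx1.trans h1))
    _ ≤ (Real.sqrt F * Real.exp (c / 4 * s)) * (Real.sqrt F * Real.exp (c / 4 * s))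
          * (Real.sqrt F * Real.exp (c / 4 * s)) :=
        mul_le_mul (mul_le_mul hb0 hb1 (hx1.trans h1) hR0) hb2 (hx2.trans h2) (mul_nonneg hR0 hR0)
    _ = F * Real.sqrt F * Real.exp (3 * c / 4 * s) := hRRR
    _ ≤ F * Real.sqrt F * (Real.exp (-(c / 4 * s)) * Real.exp (cD * s)) :=
        mul_le_mul_of_nonneg_left hexp (by positivity)
    _ = F * Real.sqrt F * Real.exp (-(c / 4 * s)) * Real.exp (cD * s) := by ring

/-- Case 2c of the glue (transfer kernel of rank `r ≥ x1`, `r ≤ √F e^{-c_D s}`). -/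
theorem arith_case2c {x0 x1 x2 z r F s c cD : ℝ} (hx0 : 0 ≤ x0) (hx1 : 0 ≤ x1) (hx2 : 0 ≤ x2)
    (hF : 0 ≤ F) (hs : 0 ≤ s) (hc : 0 ≤ c) (hcD : c ≤ cD) (hz : 1 ≤ z)
    (hpair : x0 * x2 * z ≤ F * Real.exp (c / 2 * s))
    (hr1 : x1 ≤ r) (hr : r ≤ Real.sqrt F * Real.exp (-(cD * s))) :
    x0 * x1 * x2 ≤ F * Real.sqrt F * Real.exp (-(c / 4 * s)) := by
  have hexp : Real.exp (-(cD * s)) * Real.exp (c / 2 * s) ≤ Real.exp (-(c / 4 * s)) := by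
    rw [← Real.exp_add, Real.exp_le_exp]
    have h1 := mul_le_mul_of_nonneg_right hcD hs
    have h2 := mul_nonneg hc hs
    linarith
  have hz0 : 0 ≤ z := zero_le_one.trans hz
  calc x0 * x1 * x2 = x1 * (x0 * x2) := by ring
    _ ≤ x1 * (x0 * x2 * z) := by
        apply mul_le_mul_of_nonneg_left _ hx1
        calc x0 * x2 = x0 * x2 * 1 := (mul_one _).symm
          _ ≤ x0 * x2 * z := mul_le_mul_of_nonneg_left hz (mul_nonneg hx0 hx2)
    _ ≤ (Real.sqrt F * Real.exp (-(cD * s))) * (F * Real.exp (c / 2 * s)) :=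
        mul_le_mul (hr1.trans hr) hpair (mul_nonneg (mul_nonneg hx0 hx2) hz0) (by positivity)
    _ = F * Real.sqrt F * (Real.exp (-(cD * s)) * Real.exp (c / 2 * s)) := by ring
    _ ≤ F * Real.sqrt F * Real.exp (-(c / 4 * s)) := mul_le_mul_of_nonneg_left hexp (by positivity)

/-! ### The composition: the four stubs give the crux BY NAME -/

/-- `HyperoctahedralSubsets` from the four stubs (kernel-checked; no `sorry` of its own). Constants:
`Γ, c_D, n_D` from STUB D; `c_C, n_C` from STUB C at `Γ`; `c₁ ≤ min(c_C, c_D)`; STUB A at `ε = c₁/2`;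
final `c = c₁/4`, `n₀ = max n_A (max n_C n_D)`. Regime split on `z₀₂ = |C(μ 0) ∩ C(μ 2)|` against
`e^{c₁√n}`, then on activity of `X 0`, `X 2` at scale `e^{c_D√n}`. The TPP is used for
pair-injectivity of `(X 0, X 2)`, for `Q(X 0) ∩ Q(X 2) ⊆ {1}`, and for the sieve hypothesis
`x x'⁻¹ ∉ Q(X 0)Q(X 2)` (`x ≠ x'` in `X 1`). -/
theorem HyperoctahedralSubsets_of (hA : Registered.stub_hostPacking)
    (hB : Registered.stub_kernelSieve) (hC : Registered.stub_hostPairRank)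
    (hD : Registered.stub_activePairTransfer) :
    Summit.MatrixMultiplication.MatrixMultiplication.Theses.SnSubsetDichotomy.HyperoctahedralSubsets := by
  -- constants
  obtain ⟨Γ, hΓ, cD, hcD, nD, hDn⟩ := hD
  obtain ⟨cC, hcC, nC, hCn⟩ := hC Γ hΓ
  obtain ⟨c₁, hc₁C, hc₁D, hc₁⟩ : ∃ c₁ : ℝ, c₁ ≤ cC ∧ c₁ ≤ cD ∧ 0 < c₁ :=
    ⟨min cC cD, min_le_left _ _, min_le_right _ _, lt_min hcC hcD⟩
  obtain ⟨nA, hAn⟩ := hA (c₁ / 2) (by positivity)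
  refine ⟨c₁ / 4, by positivity, max nA (max nC nD), ?_⟩
  intro n hn μ hμ X hX hTPP
  have hnA : nA ≤ n := le_trans (le_max_left _ _) hn
  have hnC : nC ≤ n := le_trans ((le_max_left _ _).trans (le_max_right _ _)) hn
  have hnD : nD ≤ n := le_trans ((le_max_right _ _).trans (le_max_right _ _)) hn
  have hs0 : (0 : ℝ) ≤ Real.sqrt (n : ℝ) := Real.sqrt_nonneg _
  have hF0 : (0 : ℝ) ≤ (n.factorial : ℝ) := Nat.cast_nonneg _
  -- the goal in product form
  rw [rpow_three_halves _ hF0]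
  push_cast
  -- hosts
  have hXB : ∀ i, X i ⊆ host (μ i) := fun i σ hσ =>
    Finset.mem_filter.mpr ⟨Finset.mem_univ _, hX i σ hσ⟩
  have h1mem : ∀ i, (1 : Equiv.Perm (Fin n)) ∈ host (μ i) := fun i =>
    Finset.mem_filter.mpr ⟨Finset.mem_univ _, by rw [one_mul, mul_one]⟩
  have h1B : ∀ i, ({1} : Finset (Equiv.Perm (Fin n))) ⊆ host (μ i) := fun i =>
    Finset.singleton_subset_iff.mpr (h1mem i)
  have hxle : ∀ i, ((X i).card : ℝ) ≤ ((host (μ i)).card : ℝ) := fun i => by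
    exact_mod_cast Finset.card_le_card (hXB i)
  have hx0 : ∀ i, (0 : ℝ) ≤ ((X i).card : ℝ) := fun i => Nat.cast_nonneg _
  -- trivial case: `X 1 = ∅`
  rcases (X 1).eq_empty_or_nonempty with h1e | ⟨t, ht⟩
  · rw [h1e, Finset.card_empty]; push_cast; simp only [mul_zero, zero_mul]; positivity
  -- pair-injectivity: (X 0, X 2) from the TPP, and (S, {1}) for any S
  have hpair : ∀ x ∈ X 0, ∀ x' ∈ X 0, ∀ y ∈ X 2, ∀ y' ∈ X 2,
      x * x'⁻¹ * (y * y'⁻¹) = 1 → x = x' ∧ y = y' := by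
    intro x hx x' hx' y hy y' hy' h
    have h' : x * x'⁻¹ * (t * t⁻¹) * (y * y'⁻¹) = 1 := by rw [mul_inv_cancel, mul_one]; exact h
    obtain ⟨h1, -, h3⟩ := hTPP x hx x' hx' t ht t ht y hy y' hy' h'
    exact ⟨h1, h3⟩
  have hpair1 : ∀ S : Finset (Equiv.Perm (Fin n)), ∀ x ∈ S, ∀ x' ∈ S,
      ∀ y ∈ ({1} : Finset (Equiv.Perm (Fin n))), ∀ y' ∈ ({1} : Finset (Equiv.Perm (Fin n))),
      x * x'⁻¹ * (y * y'⁻¹) = 1 → x = x' ∧ y = y' := by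
    intro S x _ x' _ y hy y' hy' h
    rw [Finset.mem_singleton] at hy hy'
    subst hy; subst hy'
    refine ⟨?_, rfl⟩
    rw [mul_inv_cancel (1 : Equiv.Perm (Fin n)), mul_one] at h
    exact mul_inv_eq_one.mp h
  -- STUB A: host sizes and the pair bound
  have hb : ∀ i, ((host (μ i)).card : ℝ) ≤
      Real.sqrt (n.factorial : ℝ) * Real.exp (c₁ / 4 * Real.sqrt (n : ℝ)) := by
    intro i
    have h := hAn n hnA (μ i) (μ i) (hμ i) (hμ i) (host (μ i)) {1} subset_rfl (h1B i) (hpair1 _)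
    rw [Finset.inter_self, Finset.card_singleton, mul_one] at h
    push_cast at h
    have hR : Real.sqrt (n.factorial : ℝ) * Real.exp (c₁ / 4 * Real.sqrt (n : ℝ))
        * (Real.sqrt (n.factorial : ℝ) * Real.exp (c₁ / 4 * Real.sqrt (n : ℝ)))
        = (n.factorial : ℝ) * Real.exp (c₁ / 2 * Real.sqrt (n : ℝ)) := by
      have he : c₁ / 4 * Real.sqrt (n : ℝ) + c₁ / 4 * Real.sqrt (n : ℝ) = c₁ / 2 * Real.sqrt (n : ℝ) := by
        ring
      rw [mul_mul_mul_comm, Real.mul_self_sqrt hF0, ← Real.exp_add, he]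
    rw [← hR] at h
    exact (mul_self_le_mul_self_iff (Nat.cast_nonneg _) (by positivity)).mpr h
  have hpairA := hAn n hnA (μ 0) (μ 2) (hμ 0) (hμ 2) (X 0) (X 2) (hXB 0) (hXB 2) hpair
  push_cast at hpairA
  -- the quotient sets of X 0 and X 2 meet only in 1 (TPP with the middle pair trivial)
  have hQ : X 0 * (X 0)⁻¹ ∩ (X 2 * (X 2)⁻¹) ⊆ {1} := by
    intro q hq
    obtain ⟨hq0, hq2⟩ := Finset.mem_inter.mp hq
    obtain ⟨a, ha, b, hb, rfl⟩ := Finset.mem_mul.mp hq0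
    obtain ⟨a', ha', rfl⟩ := Finset.mem_inv.mp hb
    obtain ⟨d, hd, e, he, hde⟩ := Finset.mem_mul.mp hq2
    obtain ⟨d', hd', rfl⟩ := Finset.mem_inv.mp he
    have h := hTPP a ha a' ha' t ht t ht d' hd' d hd (by rw [← hde]; group)
    rw [Finset.mem_singleton, h.1, mul_inv_cancel]
  -- regime split on z₀₂ = |C(μ 0) ∩ C(μ 2)|
  by_cases hz : Real.exp (c₁ * Real.sqrt (n : ℝ)) ≤ ((host (μ 0) ∩ host (μ 2)).card : ℝ)
  · -- Case 1: packing regime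
    exact arith_case1 (hx0 1) (by positivity) hF0 hz hpairA ((hxle 1).trans (hb 1))
  -- Case 2: long-cycle position; host certificate from STUB C
  have hz' : ((host (μ 0) ∩ host (μ 2)).card : ℝ) < Real.exp (c₁ * Real.sqrt (n : ℝ)) :=
    not_le.mp hz
  have hzC : ((host (μ 0) ∩ host (μ 2)).card : ℝ) ≤ Real.exp (cC * Real.sqrt (n : ℝ)) :=
    hz'.le.trans (Real.exp_le_exp.mpr (mul_le_mul_of_nonneg_right hc₁C hs0))
  have hzD : ((host (μ 0) ∩ host (μ 2)).card : ℝ) ≤ Real.exp (cD * Real.sqrt (n : ℝ)) :=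
    hz'.le.trans (Real.exp_le_exp.mpr (mul_le_mul_of_nonneg_right hc₁D hs0))
  have hcert := hCn n hnC (μ 0) (μ 2) (hμ 0) (hμ 2) hzC
  have hz1 : (1 : ℝ) ≤ ((host (μ 0) ∩ host (μ 2)).card : ℝ) := by
    have hmem : (1 : Equiv.Perm (Fin n)) ∈ host (μ 0) ∩ host (μ 2) :=
      Finset.mem_inter.mpr ⟨h1mem 0, h1mem 2⟩
    exact_mod_cast Finset.one_le_card.mpr ⟨1, hmem⟩
  by_cases ha0 : ((host (μ 0)).card : ℝ) ≤ ((X 0).card : ℝ) * Real.exp (cD * Real.sqrt (n : ℝ))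
  · by_cases ha2 : ((host (μ 2)).card : ℝ) ≤ ((X 2).card : ℝ) * Real.exp (cD * Real.sqrt (n : ℝ))
    · -- Case 2c: both active — STUB D gives the kernel, STUB B the bound on |X 1|
      obtain ⟨k, hk1, hksupp, hrank⟩ := hDn n hnD (μ 0) (μ 1) (μ 2) (hμ 0) (hμ 1) (hμ 2) hzD hcert
        (X 0) (X 2) (hXB 0) (hXB 2) ha0 ha2 hQ
      have hT4 : ∀ x ∈ X 1, ∀ x' ∈ X 1, x ≠ x' → k (x * x'⁻¹) = 0 := by
        intro x hx x' hx' hne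
        by_contra hk0
        obtain ⟨p, hp, q, hq, hpq⟩ := Finset.mem_mul.mp (hksupp _ hk0)
        obtain ⟨a, ha, b, hb, rfl⟩ := Finset.mem_mul.mp hp
        obtain ⟨a', ha', rfl⟩ := Finset.mem_inv.mp hb
        obtain ⟨d, hd, e, he, rfl⟩ := Finset.mem_mul.mp hq
        obtain ⟨d', hd', rfl⟩ := Finset.mem_inv.mp he
        have h := hTPP a' ha' a ha x hx x' hx' d' hd' d hd (by rw [← hpq]; group)
        exact hne h.2.1
      have hsieve : (X 1).card ≤ (kerMat (host (μ 1)) k).rank :=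
        hB (Equiv.Perm (Fin n)) (host (μ 1)) (X 1) k (hXB 1) hk1 hT4
      have hr1 : ((X 1).card : ℝ) ≤ ((kerMat (host (μ 1)) k).rank : ℝ) := by exact_mod_cast hsieve
      exact arith_case2c (hx0 0) (hx0 1) (hx0 2) hF0 hs0 hc₁.le hc₁D hz1 hpairA hr1 hrank
    · -- Case 2b: X 2 inactive (lopsided)
      have ha2' := not_le.mp ha2
      calc ((X 0).card : ℝ) * (X 1).card * (X 2).card = ((X 2).card : ℝ) * (X 1).card * (X 0).card := by
            ring
        _ ≤ _ := arith_case2a (hx0 2) (hx0 1) (hx0 0) hF0 hs0 hc₁D ha2' (hxle 1) (hxle 0)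
            (hb 2) (hb 1) (hb 0)
  · -- Case 2a: X 0 inactive (lopsided)
    have ha0' := not_le.mp ha0
    exact arith_case2a (hx0 0) (hx0 1) (hx0 2) hF0 hs0 hc₁D ha0' (hxle 1) (hxle 2) (hb 0) (hb 1) (hb 2)

/-- Wiring check: the registered stubs feed `HyperoctahedralSubsets_of` as stated. -/
example : Summit.MatrixMultiplication.MatrixMultiplication.Theses.SnSubsetDichotomy.HyperoctahedralSubsets :=
  HyperoctahedralSubsets_of stub_hostPacking stub_kernelSieve stub_hostPairRank
    stub_activePairTransfer

end Summit.MatrixMultiplication.MatrixMultiplication.Cruxes.HyperoctahedralSubsets.ZonalRankHamiltonianOverlay
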